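import Literature.Geometry.Lorentzian.CoordBochner
import HarnessLib

/-!
# Evolution of `Hess f`, `Δf` and `|∇f|²` along a one-parameter family of metrics, in coordinates
(Topping 2006, Prop. 2.5.6 and §6.2)

A further layer of the coordinate tensor calculus (`CoordMetricVariation`,
`CoordScalarCurvatureEvolution`, `CoordBochner`). For a smooth one-parameter family of metric
components `G : ℝ → E → (E →L E →L ℝ)` on `V × S` (`IsMetricFamilyOn G S V`, `h = ∂G/∂t = tDeriv`)
and a **time-dependent scalar function** `f : ℝ → E → ℝ`, `C^∞` on `V × S` (time derivative
`ḟ = tDerivFun f S t` within `S`), we prove, at `t ∈ S`, `x ∈ V`, all time derivatives being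
taken within `S` (one-sided at end points):

* the **metric pairing of bilinear forms** `pairAt G x α β = tr ((♯∘α) ∘ (♯∘β))`, which for
  symmetric forms is `⟨α, β⟩_G = g^{ik} g^{jl} α_{ij} β_{kl}` (O'Neill 1983, Ch. 3, pp. 60–61):
  bilinearity, symmetry, `⟨β, β⟩ = |β|²` for symmetric `β`, `⟨α, G⟩ = tr_G α`, `|G|² = dim E`,
  and the expansion `|α + β|² = |α|² + 2⟨α, β⟩ + |β|²` for symmetric `α, β`;
* `hasDerivWithinAt_fderiv_of_family`, `hasDerivWithinAt_fderiv_fderiv_of_family` —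
  `∂_t Df = Dḟ`, `∂_t D²f = D²ḟ` (mixed partials commute);
* `IsMetricFamilyOn.hasDerivWithinAt_gradSqAt` — **`∂_t |∇f|² = −h(♯Df, ♯Df) + 2 Dḟ(♯Df)`**
  (Topping 2006, proof of Prop. 6.2.1: `∂_t |∇f|² = −h(∇f,∇f) + 2⟨∇k, ∇f⟩`);
* `IsMetricFamilyOn.hasDerivWithinAt_hessAt_apply` — `∂_t Hess f (Y,Z) = Hess ḟ (Y,Z) − Df(Π(Y,Z))`,
  `Π = ∂_t Γ` (Topping 2006, Prop. 2.3.1);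
* `IsMetricFamilyOn.sum_dginv_mul_eq` — `Σ (∂_t g^{kl}) β_{kl} = −⟨h, β⟩`;
* `IsMetricFamilyOn.hasDerivWithinAt_lapAt` — **`∂_t Δf = Δḟ − ⟨h, Hess f⟩ − Df(tr_G Π)`**
  (Topping 2006, Prop. 2.3.10 ff.), and **Topping 2006, Prop. 2.5.6 in coordinates**,
  `hasDerivWithinAt_lapAt_ricciFlow`: under the Ricci flow in coordinates `h = −2 Ric(G)` (where
  `tr_G Π = 0` by the contracted Bianchi identity, `sum_ginv_smul_varChrAt_eq_zero`),
  `∂_t Δf = Δ ḟ + 2⟨Ric, Hess f⟩`;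
* `IsMetricFamilyOn.hasDerivWithinAt_gradSqAt_ricciFlow` — `∂_t |∇f|² = 2 Ric(♯Df, ♯Df) + 2 Dḟ(♯Df)`
  under the flow.

These are the evolution formulae entering Perelman's entropy formula (Perelman 2002, (3.4) and
Prop. 9.1; Topping 2006, Prop. 8.2.6). Everything is proved; the file introduces the definitions
`pairAt`, `tDerivFun` (explicit expressions) and no statement of `Prop` type is assumed.

## References

* P. Topping, *Lectures on the Ricci flow*, LMS Lecture Note Series 325, CUP 2006, Prop. 2.3.1,
  Prop. 2.3.10, Prop. 2.5.6, Prop. 6.2.1, Prop. 8.2.6. [Topping2006]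
* G. Perelman, *The entropy formula for the Ricci flow and its geometric applications*,
  arXiv:math/0211159 (2002), §3 (3.4), §9 Prop. 9.1. [Perelman2002]
* B. O'Neill, *Semi-Riemannian geometry with applications to relativity*, Academic Press 1983,
  Ch. 3, pp. 60–61 (metric contractions). [ONeill1983]
-/

noncomputable section

set_option maxSynthPendingDepth 3

open Set Filter ContinuousLinearMap Module
open scoped Topology ContDiff

namespace Literature.Geometry.Lorentzian

namespace MetricCoord

variable {E : Type*} [NormedAddCommGroup E] [NormedSpace ℝ E]

/-! ### The metric pairing of bilinear forms -/

section Pairing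

variable [FiniteDimensional ℝ E] (G : E → E →L[ℝ] E →L[ℝ] ℝ)

/-- The **metric pairing** `pairAt G x α β = tr ((♯∘α) ∘ (♯∘β))` of two bilinear forms at `x`;
for symmetric `β` this is `⟨α, β⟩_G = g^{ik} g^{jl} α_{ij} β_{kl}` (O'Neill 1983, Ch. 3,
pp. 60–61, metric contraction; Topping 2006, §2.1, the inner product extended to tensors), and
`pairAt G x β β = |β|²_G = normSqAt G x β` for symmetric `β` (`pairAt_self_of_symm`).
[cite: ONeill1983, Ch. 3, pp. 60–61] -/
def pairAt (x : E) (α β : E →L[ℝ] E →L[ℝ] ℝ) : ℝ :=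
  traceCLM E (((sharpAt G x).comp α).comp ((sharpAt G x).comp β))

/-- Unfolding lemma for `pairAt`. [cite: ONeill1983, Ch. 3, pp. 60–61] -/
theorem pairAt_apply (x : E) (α β : E →L[ℝ] E →L[ℝ] ℝ) :
    pairAt G x α β = traceCLM E (((sharpAt G x).comp α).comp ((sharpAt G x).comp β)) := rfl

/-- `⟨β, β⟩_G = |β|²_G` for a symmetric form. [cite: ONeill1983, Ch. 3, pp. 60–61] -/
theorem pairAt_self_of_symm (x : E) {β : E →L[ℝ] E →L[ℝ] ℝ} (hβ : ∀ v w, β v w = β w v) :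
    pairAt G x β β = normSqAt G x β := by
  have hflip : β.flip = β := by ext v w; exact hβ w v
  rw [pairAt, normSqAt_eq_traceCLM, hflip]

/-- The pairing is symmetric (`tr (AB) = tr (BA)`). [folklore] -/
theorem pairAt_comm (x : E) (α β : E →L[ℝ] E →L[ℝ] ℝ) : pairAt G x α β = pairAt G x β α := by
  rw [pairAt, pairAt, traceCLM_comp_comm]

/-- The pairing is additive in the first slot. [folklore] -/
theorem pairAt_add_left (x : E) (α₁ α₂ β : E →L[ℝ] E →L[ℝ] ℝ) :
    pairAt G x (α₁ + α₂) β = pairAt G x α₁ β + pairAt G x α₂ β := by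
  simp only [pairAt, ContinuousLinearMap.comp_add, ContinuousLinearMap.add_comp, map_add]

/-- The pairing is homogeneous in the first slot. [folklore] -/
theorem pairAt_smul_left (x : E) (c : ℝ) (α β : E →L[ℝ] E →L[ℝ] ℝ) :
    pairAt G x (c • α) β = c * pairAt G x α β := by
  simp only [pairAt, ContinuousLinearMap.comp_smul, ContinuousLinearMap.smul_comp, map_smul,
    smul_eq_mul]

/-- The pairing is additive in the second slot. [folklore] -/
theorem pairAt_add_right (x : E) (α β₁ β₂ : E →L[ℝ] E →L[ℝ] ℝ) :
    pairAt G x α (β₁ + β₂) = pairAt G x α β₁ + pairAt G x α β₂ := by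
  rw [pairAt_comm, pairAt_add_left, pairAt_comm G x β₁, pairAt_comm G x β₂]

/-- The pairing is homogeneous in the second slot. [folklore] -/
theorem pairAt_smul_right (x : E) (c : ℝ) (α β : E →L[ℝ] E →L[ℝ] ℝ) :
    pairAt G x α (c • β) = c * pairAt G x α β := by
  rw [pairAt_comm, pairAt_smul_left, pairAt_comm G x β]

/-- The pairing with `−β`. [folklore] -/
theorem pairAt_neg_right (x : E) (α β : E →L[ℝ] E →L[ℝ] ℝ) :
    pairAt G x α (-β) = -pairAt G x α β := by
  rw [show -β = (-1 : ℝ) • β by simp, pairAt_smul_right]; ring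

/-- The pairing with `−α`. [folklore] -/
theorem pairAt_neg_left (x : E) (α β : E →L[ℝ] E →L[ℝ] ℝ) :
    pairAt G x (-α) β = -pairAt G x α β := by
  rw [show -α = (-1 : ℝ) • α by simp, pairAt_smul_left]; ring

/-- The pairing of differences in the second slot. [folklore] -/
theorem pairAt_sub_right (x : E) (α β₁ β₂ : E →L[ℝ] E →L[ℝ] ℝ) :
    pairAt G x α (β₁ - β₂) = pairAt G x α β₁ - pairAt G x α β₂ := by
  rw [sub_eq_add_neg, pairAt_add_right, pairAt_neg_right, ← sub_eq_add_neg]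

variable {G} {x : E}

/-- **`⟨α, G⟩_G = tr_G α`**: pairing with the metric is the metric trace (`♯ ∘ G_x = id`).
[cite: ONeill1983, Ch. 3, pp. 60–61] -/
theorem pairAt_metric_right (hx : (G x).IsInvertible) (α : E →L[ℝ] E →L[ℝ] ℝ) :
    pairAt G x α (G x) = mtrAt G x α := by
  rw [pairAt, mtrAt_eq_traceCLM, show (sharpAt G x).comp (G x) = ContinuousLinearMap.id ℝ E from
    hx.inverse_comp_self, ContinuousLinearMap.comp_id]

/-- **`|G|²_G = dim E`** (`tr id`). [cite: ONeill1983, Ch. 3, pp. 60–61] -/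
theorem normSqAt_metric (hx : (G x).IsInvertible) (hs : ∀ v w : E, G x v w = G x w v) :
    normSqAt G x (G x) = finrank ℝ E := by
  rw [← pairAt_self_of_symm G x hs, pairAt_metric_right hx, mtrAt_eq_traceCLM,
    show (sharpAt G x).comp (G x) = ContinuousLinearMap.id ℝ E from hx.inverse_comp_self,
    traceCLM_apply]
  simp

/-- **`|α + β|² = |α|² + 2⟨α, β⟩ + |β|²`** for symmetric forms. [cite: ONeill1983, Ch. 3, pp. 60–61] -/
theorem normSqAt_add_of_symm {α β : E →L[ℝ] E →L[ℝ] ℝ} (hα : ∀ v w, α v w = α w v)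
    (hβ : ∀ v w, β v w = β w v) :
    normSqAt G x (α + β) = normSqAt G x α + 2 * pairAt G x α β + normSqAt G x β := by
  have hαβ : ∀ v w, (α + β) v w = (α + β) w v := fun v w ↦ by
    simp only [_root_.add_apply, hα v w, hβ v w]
  rw [← pairAt_self_of_symm G x hαβ, ← pairAt_self_of_symm G x hα, ← pairAt_self_of_symm G x hβ,
    pairAt_add_left, pairAt_add_right, pairAt_add_right, pairAt_comm G x β α]
  ring

/-- `|α − β|² = |α|² − 2⟨α, β⟩ + |β|²` for symmetric forms. [cite: ONeill1983, Ch. 3, pp. 60–61] -/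
theorem normSqAt_sub_of_symm {α β : E →L[ℝ] E →L[ℝ] ℝ} (hα : ∀ v w, α v w = α w v)
    (hβ : ∀ v w, β v w = β w v) :
    normSqAt G x (α - β) = normSqAt G x α - 2 * pairAt G x α β + normSqAt G x β := by
  have hnβ : ∀ v w, (-β) v w = (-β) w v := fun v w ↦ by simp only [_root_.neg_apply, hβ v w]
  rw [sub_eq_add_neg, normSqAt_add_of_symm hα hnβ, pairAt_neg_right,
    ← pairAt_self_of_symm G x hnβ, pairAt_neg_left, pairAt_neg_right, pairAt_self_of_symm G x hβ]
  ring

/-- `|c β|² = c² |β|²`. [cite: ONeill1983, Ch. 3, pp. 60–61] -/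
theorem normSqAt_smul (c : ℝ) (β : E →L[ℝ] E →L[ℝ] ℝ) :
    normSqAt G x (c • β) = c ^ 2 * normSqAt G x β := by
  simp only [normSqAt_eq_traceCLM, ContinuousLinearMap.flip_smul, ContinuousLinearMap.comp_smul,
    ContinuousLinearMap.smul_comp, map_smul, smul_eq_mul]
  ring

/-- **`|α − c G|² = |α|² − 2c tr_G α + c² dim E`** for a symmetric form `α`: the expansion behind
`|Ric + Hess f − g/2τ|² = |Ric + Hess f|² − (R + Δf)/τ + n/4τ²` (Topping 2006, end of the proof of
Prop. 8.2.6). [cite: Topping2006, proof of Prop. 8.2.6] -/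
theorem normSqAt_sub_smul_metric (hx : (G x).IsInvertible) (hs : ∀ v w : E, G x v w = G x w v)
    {α : E →L[ℝ] E →L[ℝ] ℝ} (hα : ∀ v w, α v w = α w v) (c : ℝ) :
    normSqAt G x (α - c • G x) = normSqAt G x α - 2 * c * mtrAt G x α + c ^ 2 * finrank ℝ E := by
  have hcG : ∀ v w, (c • G x) v w = (c • G x) w v := fun v w ↦ by
    simp only [_root_.smul_apply, hs v w]
  rw [normSqAt_sub_of_symm hα hcG, pairAt_smul_right, pairAt_metric_right hx, normSqAt_smul,
    normSqAt_metric hx hs]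
  ring

variable {ι : Type*} [Fintype ι] (b : Basis ι ℝ E)

/-- **The pairing as a trace in a basis**: `⟨α, β⟩ = Σ_k bᵏ(♯ α(♯ β(b_k,·), ·))`, i.e.
`tr ((♯α)(♯β)) = Σ_k bᵏ((♯α)((♯β) b_k))`. [folklore] -/
theorem pairAt_eq_sum_coord (α β : E →L[ℝ] E →L[ℝ] ℝ) :
    pairAt G x α β = ∑ k, b.coord k (sharpAt G x (α (sharpAt G x (β (b k))))) := by
  rw [pairAt, traceCLM_apply, trace_eq_sum_coord b]
  rfl

end Pairing

/-! ### Time-dependent scalar functions: mixed partials -/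

section ScalarFamily

variable {V : Set E} {S : Set ℝ} {x : E} {t : ℝ}

/-- The **time derivative** `ḟ_t = ∂f/∂t` of a time-dependent scalar function `f : ℝ → E → ℝ`, at
`x`, within the time set `S` (one-sided at end points), as a function on `E`. [cite: Topping2006, §2.3] -/
def tDerivFun (f : ℝ → E → ℝ) (S : Set ℝ) (t : ℝ) (x : E) : ℝ :=
  derivWithin (fun s ↦ f s x) S t

variable {f : ℝ → E → ℝ}

/-- The time slices have derivative `ḟ` within `S`. [folklore] -/
theorem hasDerivWithinAt_of_family (hf : ContDiffOn ℝ ∞ (fun p : E × ℝ ↦ f p.2 p.1) (V ×ˢ S))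
    (hx : x ∈ V) (ht : t ∈ S) :
    HasDerivWithinAt (fun s ↦ f s x) (tDerivFun f S t x) S t := by
  have h := hasDerivWithinAt_tslice (F := fun p : E × ℝ ↦ f p.2 p.1) (hf.differentiableOn (by simp)) hx ht
  exact h.differentiableWithinAt.hasDerivWithinAt

/-- The slices `f s` are `C^∞` on `V`. [folklore] -/
theorem contDiffOn_of_family (hf : ContDiffOn ℝ ∞ (fun p : E × ℝ ↦ f p.2 p.1) (V ×ˢ S)) (ht : t ∈ S) :
    ContDiffOn ℝ ∞ (f t) V := by
  have hmap : ContDiffOn ℝ ∞ (fun y : E ↦ (y, t)) V := (contDiff_id.prodMk contDiff_const).contDiffOn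
  exact hf.comp hmap fun y hy ↦ ⟨hy, ht⟩

/-- `ḟ_t` is `C^∞` on `V`. [folklore] -/
theorem contDiffOn_tDerivFun (hV : IsOpen V) (hS : UniqueDiffOn ℝ S)
    (hf : ContDiffOn ℝ ∞ (fun p : E × ℝ ↦ f p.2 p.1) (V ×ˢ S)) (ht : t ∈ S) :
    ContDiffOn ℝ ∞ (tDerivFun f S t) V :=
  contDiffOn_derivWithin_tslice (F := fun p : E × ℝ ↦ f p.2 p.1) hV hS hf ht

/-- **`∂_t Df = Dḟ`**: the differential of the slices is differentiable in `t` within `S`, with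
derivative the differential of `ḟ` (mixed partials commute for a `C^∞` function on `V × S`).
[folklore] -/
theorem hasDerivWithinAt_fderiv_of_family (hV : IsOpen V) (hS : UniqueDiffOn ℝ S)
    (hS' : S ⊆ closure (interior S))
    (hf : ContDiffOn ℝ ∞ (fun p : E × ℝ ↦ f p.2 p.1) (V ×ˢ S)) (hx : x ∈ V) (ht : t ∈ S) :
    HasDerivWithinAt (fun s ↦ fderiv ℝ (f s) x) (fderiv ℝ (tDerivFun f S t) x) S t :=
  hasDerivWithinAt_fderiv_slice (F := fun p : E × ℝ ↦ f p.2 p.1) hV hS hf hx ht (hS' ht)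

/-- The field of differentials `(y, s) ↦ Df_s(y)` is `C^∞` on `V × S`. [folklore] -/
theorem contDiffOn_fderiv_of_family (hV : IsOpen V) (hS : UniqueDiffOn ℝ S)
    (hf : ContDiffOn ℝ ∞ (fun p : E × ℝ ↦ f p.2 p.1) (V ×ˢ S)) :
    ContDiffOn ℝ ∞ (fun p : E × ℝ ↦ fderiv ℝ (f p.2) p.1) (V ×ˢ S) :=
  contDiffOn_fderiv_slice (F := fun p : E × ℝ ↦ f p.2 p.1) hV hS hf

/-- **`∂_t D²f = D²ḟ`**: the second differential of the slices is differentiable in `t` within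
`S`, with derivative the second differential of `ḟ`. [folklore] -/
theorem hasDerivWithinAt_fderiv_fderiv_of_family (hV : IsOpen V) (hS : UniqueDiffOn ℝ S)
    (hS' : S ⊆ closure (interior S))
    (hf : ContDiffOn ℝ ∞ (fun p : E × ℝ ↦ f p.2 p.1) (V ×ˢ S)) (hx : x ∈ V) (ht : t ∈ S) :
    HasDerivWithinAt (fun s ↦ fderiv ℝ (fderiv ℝ (f s)) x)
      (fderiv ℝ (fderiv ℝ (tDerivFun f S t)) x) S t := by
  -- apply the first-order statement to the family of differentials
  have h2 := hasDerivWithinAt_fderiv_slice (F := fun p : E × ℝ ↦ fderiv ℝ (f p.2) p.1) hV hS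
    (contDiffOn_fderiv_of_family hV hS hf) hx ht (hS' ht)
  -- and identify the time derivative of `Df_s(y)` with `Dḟ(y)` near `x`
  have heq : (fun y ↦ derivWithin (fun s ↦ fderiv ℝ (f s) y) S t) =ᶠ[𝓝 x]
      fun y ↦ fderiv ℝ (tDerivFun f S t) y := by
    filter_upwards [hV.mem_nhds hx] with y hy
    exact (hasDerivWithinAt_fderiv_of_family hV hS hS' hf hy ht).derivWithin (hS t ht)
  rw [← heq.fderiv_eq]
  exact h2

end ScalarFamily

/-! ### Evolution of `|∇f|²`, `Hess f` and `Δf` along a metric family -/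

namespace IsMetricFamilyOn

variable [FiniteDimensional ℝ E] [CompleteSpace E]
  {G : ℝ → E → E →L[ℝ] E →L[ℝ] ℝ} {S : Set ℝ} {V : Set E} {x : E} {t : ℝ} {f : ℝ → E → ℝ}

omit [FiniteDimensional ℝ E] in
/-- **`∂_t |∇f|² = −h(♯Df, ♯Df) + 2 Dḟ(♯Df)`** along a metric family (Topping 2006, proof of
Prop. 6.2.1: "keeping in mind that `∂_t g^{ij} = −h^{ij}`, we may calculate
`∂_t |∇f|² = −h(∇f,∇f) + 2⟨∇k, ∇f⟩`", `k = ḟ`). [cite: Topping2006, proof of Prop. 6.2.1] -/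
theorem hasDerivWithinAt_gradSqAt (hG : IsMetricFamilyOn G S V)
    (hf : ContDiffOn ℝ ∞ (fun p : E × ℝ ↦ f p.2 p.1) (V ×ˢ S)) (hx : x ∈ V) (ht : t ∈ S) :
    HasDerivWithinAt (fun s ↦ gradSqAt (G s) (f s) x)
      (-tDeriv G S t x (sharpAt (G t) x (fderiv ℝ (f t) x)) (sharpAt (G t) x (fderiv ℝ (f t) x))
        + 2 * fderiv ℝ (tDerivFun f S t) x (sharpAt (G t) x (fderiv ℝ (f t) x))) S t := by
  have hi := (hG.isMetricOn t ht).isInvertible x hx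
  have hs := (hG.isMetricOn t ht).symm x hx
  have ha := hasDerivWithinAt_fderiv_of_family (hG.isOpen ht) hG.uniqueDiffOn
    hG.subset_closure_interior hf hx ht
  have hσ := hG.hasDerivWithinAt_sharpAt hx ht
  -- `s ↦ ♯_s Df_s`
  have hc := hσ.clm_apply ha
  -- `s ↦ Df_s (♯_s Df_s)`
  have hprod := ha.clm_apply hc
  refine hprod.congr_deriv ?_
  set φ := fderiv ℝ (f t) x
  set ψ := fderiv ℝ (tDerivFun f S t) x
  simp only [_root_.neg_apply, ContinuousLinearMap.comp_apply, map_add, map_neg]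
  -- `φ(♯α) = α(♯φ)` for the symmetric `G t x`
  have hswap : ∀ α : E →L[ℝ] ℝ, φ (sharpAt (G t) x α) = α (sharpAt (G t) x φ) := by
    intro α
    rw [← apply_sharpAt_apply hi φ (sharpAt (G t) x α), hs, apply_sharpAt_apply hi]
  rw [hswap (tDeriv G S t x (sharpAt (G t) x φ)), hswap ψ]
  ring

omit [FiniteDimensional ℝ E] in
/-- **`∂_t Hess f (Y,Z) = Hess ḟ (Y,Z) − Df(Π(Y,Z))`** along a metric family, `Π = ∂Γ/∂t`
(Topping 2006, Prop. 2.3.1: `∂_t ∇_Y Z = Π(Y,Z)`, applied to `Hess f(Y,Z) = Y Z f − (∇_Y Z) f`).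
[cite: Topping2006, Prop. 2.3.1] -/
theorem hasDerivWithinAt_hessAt_apply (hG : IsMetricFamilyOn G S V)
    (hf : ContDiffOn ℝ ∞ (fun p : E × ℝ ↦ f p.2 p.1) (V ×ˢ S)) (hx : x ∈ V) (ht : t ∈ S) (Y Z : E) :
    HasDerivWithinAt (fun s ↦ hessAt (G s) (f s) x Y Z)
      (hessAt (G t) (tDerivFun f S t) x Y Z - fderiv ℝ (f t) x (varChrAt G S t x Y Z)) S t := by
  have ha := hasDerivWithinAt_fderiv_of_family (hG.isOpen ht) hG.uniqueDiffOn
    hG.subset_closure_interior hf hx ht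
  have ha2 := hasDerivWithinAt_fderiv_fderiv_of_family (hG.isOpen ht) hG.uniqueDiffOn
    hG.subset_closure_interior hf hx ht
  have hΓ := hG.hasDerivWithinAt_chrAt hx ht
  -- `s ↦ D²f_s (Y, Z)`
  have h1 : HasDerivWithinAt (fun s ↦ fderiv ℝ (fderiv ℝ (f s)) x Y Z)
      (fderiv ℝ (fderiv ℝ (tDerivFun f S t)) x Y Z) S t := by
    have := (ha2.clm_apply (hasDerivWithinAt_const t S Y)).clm_apply (hasDerivWithinAt_const t S Z)
    simpa using this
  -- `s ↦ Γ_s (Y, Z)`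
  have h2 : HasDerivWithinAt (fun s ↦ chrAt (G s) x Y Z) (varChrAt G S t x Y Z) S t := by
    have := (hΓ.clm_apply (hasDerivWithinAt_const t S Y)).clm_apply (hasDerivWithinAt_const t S Z)
    simpa using this
  -- `s ↦ Df_s (Γ_s(Y,Z))`
  have h3 := ha.clm_apply h2
  have h := h1.sub h3
  refine (h.congr_of_eventuallyEq_of_mem ?_ ht).congr_deriv ?_
  · exact Filter.Eventually.of_forall fun s ↦ by simp [hessAt_apply]
  · simp only [hessAt_apply]
    ring

omit [CompleteSpace E] in
/-- **`Σ_{kl} (∂_t g^{kl}) β(b_k, b_l) = −⟨h, β⟩_G`**: the derivative of the inverse metric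
coefficients contracted against a bilinear form is minus the metric pairing with `h = ∂G/∂t`
(`∂_t g^{kl} = −g^{ka} h_{ab} g^{bl}`; Topping 2006, Prop. 2.3.6). [cite: Topping2006, Prop. 2.3.6] -/
theorem sum_dginv_mul_eq {ι : Type*} [Fintype ι] (b : Basis ι ℝ E) (hG : IsMetricFamilyOn G S V)
    (ht : t ∈ S) (β : E →L[ℝ] E →L[ℝ] ℝ) :
    ∑ k, ∑ l, b.coord k (-(sharpAt (G t) x (tDeriv G S t x (sharpAt (G t) x (coordCLM b l)))))
      * β (b k) (b l) = -pairAt (G t) x (tDeriv G S t x) β := by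
  have _ := hG.isMetricOn t ht
  rw [pairAt_eq_sum_coord b, ← Finset.sum_neg_distrib]
  refine Finset.sum_congr rfl fun k _ ↦ ?_
  have hβk : β (b k) = ∑ l, β (b k) (b l) • coordCLM b l := eq_sum_smul_coordCLM b (β (b k))
  conv_rhs => rw [hβk]
  simp only [map_sum, map_smul, map_neg, smul_eq_mul, neg_mul, Finset.sum_neg_distrib]
  congr 1
  refine Finset.sum_congr rfl fun l _ ↦ ?_
  ring

/-- **The evolution of the Laplacian along a metric family** (Topping 2006, Prop. 2.3.10 and its
proof, for the exact form `df`): within `S`,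

  `∂_t Δf = Δ ḟ − ⟨h, Hess f⟩ − Df(tr_G Π)`,

where `tr_G Π = Σ g^{kl} Π(b_k, b_l)` is the metric trace of the variation `Π = ∂Γ/∂t` of the
Christoffel map (the vector `(div h − ½ d tr h)^♯`). Proof: differentiate
`Δf = Σ g^{kl} Hess f(b_k,b_l)` termwise (`hasDerivWithinAt_ginv`, `hasDerivWithinAt_hessAt_apply`)
and contract (`sum_dginv_mul_eq`). [cite: Topping2006, Prop. 2.3.10] -/
theorem hasDerivWithinAt_lapAt {ι : Type*} [Fintype ι] (b : Basis ι ℝ E) (hG : IsMetricFamilyOn G S V)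
    (hf : ContDiffOn ℝ ∞ (fun p : E × ℝ ↦ f p.2 p.1) (V ×ˢ S)) (hx : x ∈ V) (ht : t ∈ S) :
    HasDerivWithinAt (fun s ↦ lapAt (G s) (f s) x)
      (lapAt (G t) (tDerivFun f S t) x - pairAt (G t) x (tDeriv G S t x) (hessAt (G t) (f t) x)
        - fderiv ℝ (f t) x (∑ k, ∑ l, ginv (G t) b x k l • varChrAt G S t x (b k) (b l))) S t := by
  have heq : (fun s ↦ lapAt (G s) (f s) x) =
      fun s ↦ ∑ k, ∑ l, ginv (G s) b x k l * hessAt (G s) (f s) x (b k) (b l) :=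
    funext fun s ↦ by rw [lapAt, mtrAt_eq_sum b]
  rw [heq]
  have hsum : HasDerivWithinAt (fun s ↦ ∑ k, ∑ l, ginv (G s) b x k l * hessAt (G s) (f s) x (b k) (b l))
      (∑ k, ∑ l, (b.coord k (-(sharpAt (G t) x (tDeriv G S t x (sharpAt (G t) x (coordCLM b l)))))
          * hessAt (G t) (f t) x (b k) (b l)
        + ginv (G t) b x k l * (hessAt (G t) (tDerivFun f S t) x (b k) (b l)
            - fderiv ℝ (f t) x (varChrAt G S t x (b k) (b l))))) S t :=
    HasDerivWithinAt.fun_sum fun k _ ↦ HasDerivWithinAt.fun_sum fun l _ ↦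
      (hG.hasDerivWithinAt_ginv b hx ht k l).mul (hG.hasDerivWithinAt_hessAt_apply hf hx ht (b k) (b l))
  refine hsum.congr_deriv ?_
  rw [Finset.sum_congr rfl fun k _ ↦ Finset.sum_add_distrib, Finset.sum_add_distrib,
    hG.sum_dginv_mul_eq b ht, lapAt, mtrAt_eq_sum b]
  simp only [mul_sub, Finset.sum_sub_distrib, map_sum, map_smul, smul_eq_mul, hessAt_apply]
  ring

/-! ### Under the Ricci flow in coordinates: Topping's Prop. 2.5.6 -/

section RicciFlow

variable (hG : IsMetricFamilyOn G S V)
  (hfl : ∀ s ∈ S, ∀ y ∈ V, tDeriv G S s y = (-2 : ℝ) • ricAt (G s) y)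
include hG hfl

/-- **Topping 2006, Prop. 2.5.6, in coordinates (evolution of the Laplacian under the Ricci
flow).** Let `G` be a smooth one-parameter family of metric components on `V × S` satisfying the
Ricci flow equation in coordinates `∂G/∂t = −2 Ric(G)`, and `f` a time-dependent function, `C^∞`
on `V × S`. Then within `S`, at `t ∈ S`, `x ∈ V`:

  `∂_t Δf = Δ ḟ + 2⟨Ric, Hess f⟩`

("using the contracted second Bianchi identity": the trace `tr_G Π` of the Christoffel variation
vanishes under the flow, `sum_ginv_smul_varChrAt_eq_zero`, and `−⟨h, Hess f⟩ = 2⟨Ric, Hess f⟩`).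
[cite: Topping2006, Prop. 2.5.6] -/
theorem hasDerivWithinAt_lapAt_ricciFlow
    (hf : ContDiffOn ℝ ∞ (fun p : E × ℝ ↦ f p.2 p.1) (V ×ˢ S)) (hx : x ∈ V) (ht : t ∈ S) :
    HasDerivWithinAt (fun s ↦ lapAt (G s) (f s) x)
      (lapAt (G t) (tDerivFun f S t) x
        + 2 * pairAt (G t) x (ricAt (G t) x) (hessAt (G t) (f t) x)) S t := by
  set b := Module.finBasis ℝ E
  refine (hG.hasDerivWithinAt_lapAt b hf hx ht).congr_deriv ?_
  rw [hG.sum_ginv_smul_varChrAt_eq_zero b hfl ht hx, map_zero, sub_zero, hfl t ht x hx,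
    pairAt_smul_left]
  ring

/-- **`∂_t |∇f|² = 2 Ric(♯Df, ♯Df) + 2 Dḟ(♯Df)` under the Ricci flow in coordinates**
(Topping 2006, proof of Prop. 8.2.6: "using also the evolution equation for `g`,
`(∂_t)|∇f|² = 2Ric(∇f,∇f) + 2⟨∇f, ∇ ∂f/∂t⟩`"). [cite: Topping2006, proof of Prop. 8.2.6] -/
theorem hasDerivWithinAt_gradSqAt_ricciFlow
    (hf : ContDiffOn ℝ ∞ (fun p : E × ℝ ↦ f p.2 p.1) (V ×ˢ S)) (hx : x ∈ V) (ht : t ∈ S) :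
    HasDerivWithinAt (fun s ↦ gradSqAt (G s) (f s) x)
      (2 * ricAt (G t) x (sharpAt (G t) x (fderiv ℝ (f t) x)) (sharpAt (G t) x (fderiv ℝ (f t) x))
        + 2 * fderiv ℝ (tDerivFun f S t) x (sharpAt (G t) x (fderiv ℝ (f t) x))) S t := by
  refine (hG.hasDerivWithinAt_gradSqAt hf hx ht).congr_deriv ?_
  rw [hfl t ht x hx]
  simp only [_root_.smul_apply, smul_eq_mul]
  ring

end RicciFlow

end IsMetricFamilyOn

end MetricCoord

end Literature.Geometry.Lorentzian

end
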